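import Mathlib

/-!
# Ahlswede–Daykin steps for an OR-tail with ANY set of sure entries (blind cell PercRepro2,
night-2 g14; proofs/NIGHT2-DARC.md §49)

`ad_pointwise` (the four functions theorem on `U.powerset`, pointwise form) and its four
instances on the entry states `W ∩ ent` of a cluster lattice: `fiber_holley` (Holley between two
comparable states of the gate), `fiber_cov` (FKG within one state), `ideal_mean` (the entry-free
state of the `R`-law has smaller marker means than the whole law), `level_holley` (the gate on a
join-closed set of entered clusters is Holley-above the `R`-law).
-/

namespace Summit.Ventures.PercRepro2.Coin

open Classical

section GateAbstract

variable {V : Type*} [DecidableEq V] {R : Type*} [Field R] [LinearOrder R] [IsStrictOrderedRing R]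

/-- The four functions theorem on `U.powerset`, pointwise form. -/
theorem ad_pointwise (U : Finset V) (F₁ F₂ F₃ F₄ : Finset V → R)
    (h₁ : ∀ W, 0 ≤ F₁ W) (h₂ : ∀ W, 0 ≤ F₂ W) (h₃ : ∀ W, 0 ≤ F₃ W) (h₄ : ∀ W, 0 ≤ F₄ W)
    (h : ∀ s ⊆ U, ∀ t ⊆ U, F₁ s * F₂ t ≤ F₃ (s ∩ t) * F₄ (s ∪ t)) :
    (∑ W ∈ U.powerset, F₁ W) * (∑ W ∈ U.powerset, F₂ W) ≤
      (∑ W ∈ U.powerset, F₃ W) * (∑ W ∈ U.powerset, F₄ W) := by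
  have g₁ : (0 : Finset V → R) ≤ F₁ := fun W => h₁ W
  have g₂ : (0 : Finset V → R) ≤ F₂ := fun W => h₂ W
  have g₃ : (0 : Finset V → R) ≤ F₃ := fun W => h₃ W
  have g₄ : (0 : Finset V → R) ≤ F₄ := fun W => h₄ W
  have key := Finset.four_functions_theorem U g₁ g₂ g₃ g₄ (fun s hs t ht => h s hs t ht)
    (𝒜 := U.powerset) (ℬ := U.powerset) le_rfl le_rfl
  simpa only [Finset.powerset_infs_powerset_self, Finset.powerset_sups_powerset_self] using key

/-- The state of a meet is the meet of the states. -/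
lemma state_inter (s t ent : Finset V) : (s ∩ t) ∩ ent = (s ∩ ent) ∩ (t ∩ ent) := by
  ext v; simp only [Finset.mem_inter]; tauto

/-- The state of a join is the join of the states. -/
lemma state_union (s t ent : Finset V) : (s ∪ t) ∩ ent = (s ∩ ent) ∪ (t ∩ ent) := by
  ext v; simp only [Finset.mem_inter, Finset.mem_union]; tauto

/-- **Holley between two states `e ⊆ e'` of the gate.** -/
theorem fiber_holley (U ent e e' : Finset V) (G' x : Finset V → R)
    (hG' : ∀ W, 0 ≤ G' W) (hx0 : ∀ W, 0 ≤ x W) (hxm : ∀ s t, x s ≤ x (s ∪ t))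
    (wMM : ∀ s ⊆ U, ∀ t ⊆ U, G' s * G' t ≤ G' (s ∩ t) * G' (s ∪ t)) (hee : e ⊆ e') :
    (∑ W ∈ U.powerset.filter (fun W => W ∩ ent = e), G' W * x W) *
        (∑ W ∈ U.powerset.filter (fun W => W ∩ ent = e'), G' W) ≤
      (∑ W ∈ U.powerset.filter (fun W => W ∩ ent = e), G' W) *
        (∑ W ∈ U.powerset.filter (fun W => W ∩ ent = e'), G' W * x W) := by
  simp only [Finset.sum_filter]
  have n₁ : ∀ W, (0 : R) ≤ (if W ∩ ent = e then G' W * x W else 0) := fun W => by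
    split_ifs <;> [exact mul_nonneg (hG' W) (hx0 W); exact le_rfl]
  have n₂ : ∀ W, (0 : R) ≤ (if W ∩ ent = e' then G' W else 0) := fun W => by
    split_ifs <;> [exact hG' W; exact le_rfl]
  have n₃ : ∀ W, (0 : R) ≤ (if W ∩ ent = e then G' W else 0) := fun W => by
    split_ifs <;> [exact hG' W; exact le_rfl]
  have n₄ : ∀ W, (0 : R) ≤ (if W ∩ ent = e' then G' W * x W else 0) := fun W => by
    split_ifs <;> [exact mul_nonneg (hG' W) (hx0 W); exact le_rfl]
  refine ad_pointwise U _ _ _ _ n₁ n₂ n₃ n₄ ?_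
  intro s hs t ht
  by_cases h1 : s ∩ ent = e
  · by_cases h2 : t ∩ ent = e'
    · have h3 : (s ∩ t) ∩ ent = e := by
        rw [state_inter, h1, h2]; exact Finset.inter_eq_left.mpr hee
      have h4 : (s ∪ t) ∩ ent = e' := by
        rw [state_union, h1, h2]; exact Finset.union_eq_right.mpr hee
      rw [if_pos h1, if_pos h2, if_pos h3, if_pos h4]
      calc G' s * x s * G' t = (G' s * G' t) * x s := by ring
        _ ≤ (G' (s ∩ t) * G' (s ∪ t)) * x (s ∪ t) :=
            mul_le_mul (wMM s hs t ht) (hxm s t) (hx0 s) (mul_nonneg (hG' _) (hG' _))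
        _ = G' (s ∩ t) * (G' (s ∪ t) * x (s ∪ t)) := by ring
    · rw [if_neg h2, mul_zero]
      exact mul_nonneg (n₃ _) (n₄ _)
  · rw [if_neg h1, zero_mul]
    exact mul_nonneg (n₃ _) (n₄ _)

/-- **FKG within one state of the gate.** -/
theorem fiber_cov (U ent e : Finset V) (G' x y : Finset V → R)
    (hG' : ∀ W, 0 ≤ G' W) (hx0 : ∀ W, 0 ≤ x W) (hy0 : ∀ W, 0 ≤ y W)
    (hxm : ∀ s t, x s ≤ x (s ∪ t)) (hym : ∀ s t, y s ≤ y (s ∪ t))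
    (wMM : ∀ s ⊆ U, ∀ t ⊆ U, G' s * G' t ≤ G' (s ∩ t) * G' (s ∪ t)) :
    (∑ W ∈ U.powerset.filter (fun W => W ∩ ent = e), G' W * x W) *
        (∑ W ∈ U.powerset.filter (fun W => W ∩ ent = e), G' W * y W) ≤
      (∑ W ∈ U.powerset.filter (fun W => W ∩ ent = e), G' W) *
        (∑ W ∈ U.powerset.filter (fun W => W ∩ ent = e), G' W * (x W * y W)) := by
  simp only [Finset.sum_filter]
  have n₁ : ∀ W, (0 : R) ≤ (if W ∩ ent = e then G' W * x W else 0) := fun W => by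
    split_ifs <;> [exact mul_nonneg (hG' W) (hx0 W); exact le_rfl]
  have n₂ : ∀ W, (0 : R) ≤ (if W ∩ ent = e then G' W * y W else 0) := fun W => by
    split_ifs <;> [exact mul_nonneg (hG' W) (hy0 W); exact le_rfl]
  have n₃ : ∀ W, (0 : R) ≤ (if W ∩ ent = e then G' W else 0) := fun W => by
    split_ifs <;> [exact hG' W; exact le_rfl]
  have n₄ : ∀ W, (0 : R) ≤ (if W ∩ ent = e then G' W * (x W * y W) else 0) := fun W => by
    split_ifs <;> [exact mul_nonneg (hG' W) (mul_nonneg (hx0 W) (hy0 W)); exact le_rfl]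
  refine ad_pointwise U _ _ _ _ n₁ n₂ n₃ n₄ ?_
  intro s hs t ht
  by_cases h1 : s ∩ ent = e
  · by_cases h2 : t ∩ ent = e
    · have h3 : (s ∩ t) ∩ ent = e := by rw [state_inter, h1, h2, Finset.inter_self]
      have h4 : (s ∪ t) ∩ ent = e := by rw [state_union, h1, h2, Finset.union_self]
      rw [if_pos h1, if_pos h2, if_pos h3, if_pos h4]
      have hyt : y t ≤ y (s ∪ t) := by rw [Finset.union_comm]; exact hym t s
      calc G' s * x s * (G' t * y t) = (G' s * G' t) * (x s * y t) := by ring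
        _ ≤ (G' (s ∩ t) * G' (s ∪ t)) * (x (s ∪ t) * y (s ∪ t)) :=
            mul_le_mul (wMM s hs t ht) (mul_le_mul (hxm s t) hyt (hy0 t) (hx0 _))
              (mul_nonneg (hx0 s) (hy0 t)) (mul_nonneg (hG' _) (hG' _))
        _ = G' (s ∩ t) * (G' (s ∪ t) * (x (s ∪ t) * y (s ∪ t))) := by ring
    · rw [if_neg h2, mul_zero]
      exact mul_nonneg (n₃ _) (n₄ _)
  · rw [if_neg h1, zero_mul]
    exact mul_nonneg (n₃ _) (n₄ _)

/-- **The ideal state is below the `R`-law**: the entry-free clusters' mean of a marker is at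
most the global mean. -/
theorem ideal_mean (U ent : Finset V) (G x : Finset V → R)
    (hG : ∀ W, 0 ≤ G W) (hx0 : ∀ W, 0 ≤ x W) (hxm : ∀ s t, x s ≤ x (s ∪ t))
    (wLL : ∀ s ⊆ U, ∀ t ⊆ U, G s * G t ≤ G (s ∩ t) * G (s ∪ t)) :
    (∑ W ∈ U.powerset.filter (fun W => W ∩ ent = ∅), G W * x W) * (∑ W ∈ U.powerset, G W) ≤
      (∑ W ∈ U.powerset.filter (fun W => W ∩ ent = ∅), G W) * (∑ W ∈ U.powerset, G W * x W) := by
  simp only [Finset.sum_filter]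
  have n₁ : ∀ W, (0 : R) ≤ (if W ∩ ent = ∅ then G W * x W else 0) := fun W => by
    split_ifs <;> [exact mul_nonneg (hG W) (hx0 W); exact le_rfl]
  have n₂ : ∀ W, (0 : R) ≤ G W := hG
  have n₃ : ∀ W, (0 : R) ≤ (if W ∩ ent = ∅ then G W else 0) := fun W => by
    split_ifs <;> [exact hG W; exact le_rfl]
  have n₄ : ∀ W, (0 : R) ≤ G W * x W := fun W => mul_nonneg (hG W) (hx0 W)
  refine ad_pointwise U _ _ _ _ n₁ n₂ n₃ n₄ ?_
  intro s hs t ht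
  by_cases h1 : s ∩ ent = ∅
  · have h3 : (s ∩ t) ∩ ent = ∅ := by
      rw [state_inter, h1, Finset.empty_inter]
    rw [if_pos h1, if_pos h3]
    calc G s * x s * G t = (G s * G t) * x s := by ring
      _ ≤ (G (s ∩ t) * G (s ∪ t)) * x (s ∪ t) :=
          mul_le_mul (wLL s hs t ht) (hxm s t) (hx0 s) (mul_nonneg (hG _) (hG _))
      _ = G (s ∩ t) * (G (s ∪ t) * x (s ∪ t)) := by ring
  · rw [if_neg h1, zero_mul]
    exact mul_nonneg (n₃ _) (n₄ _)

/-- **The gate on a level set is Holley-above the `R`-law**: for a predicate `P` on clusters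
that is closed under joins with clusters of the `R`-law on the support and forces an entry,
`(∑_P G')(∑ G x) ≤ (∑ G)(∑_P G' x)`. -/
theorem level_holley (U ent : Finset V) (G G' x : Finset V → R)
    (hG : ∀ W, 0 ≤ G W) (hG' : ∀ W, 0 ≤ G' W) (hx0 : ∀ W, 0 ≤ x W)
    (hxm : ∀ s t, x s ≤ x (s ∪ t))
    (wML : ∀ s ⊆ U, ∀ t ⊆ U, (∃ r ∈ ent, r ∈ s) → G' s * G t ≤ G (s ∩ t) * G' (s ∪ t))
    (P : Finset V → Prop) [DecidablePred P]
    (hP : ∀ s ⊆ U, ∀ t ⊆ U, P s → G' s ≠ 0 → G t ≠ 0 → P (s ∪ t) ∧ (∃ r ∈ ent, r ∈ s)) :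
    (∑ W ∈ U.powerset.filter P, G' W) * (∑ W ∈ U.powerset, G W * x W) ≤
      (∑ W ∈ U.powerset, G W) * (∑ W ∈ U.powerset.filter P, G' W * x W) := by
  simp only [Finset.sum_filter]
  have n₁ : ∀ W, (0 : R) ≤ (if P W then G' W else 0) := fun W => by
    split_ifs <;> [exact hG' W; exact le_rfl]
  have n₂ : ∀ W, (0 : R) ≤ G W * x W := fun W => mul_nonneg (hG W) (hx0 W)
  have n₃ : ∀ W, (0 : R) ≤ G W := hG
  have n₄ : ∀ W, (0 : R) ≤ (if P W then G' W * x W else 0) := fun W => by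
    split_ifs <;> [exact mul_nonneg (hG' W) (hx0 W); exact le_rfl]
  refine ad_pointwise U _ _ _ _ n₁ n₂ n₃ n₄ ?_
  intro s hs t ht
  by_cases h1 : P s
  · rw [if_pos h1]
    by_cases hs0 : G' s = 0
    · rw [hs0, zero_mul]
      exact mul_nonneg (n₃ _) (n₄ _)
    · by_cases ht0 : G t = 0
      · rw [ht0, zero_mul, mul_zero]
        exact mul_nonneg (n₃ _) (n₄ _)
      · obtain ⟨hPu, hent⟩ := hP s hs t ht h1 hs0 ht0
        rw [if_pos hPu]
        have hxt : x t ≤ x (s ∪ t) := by rw [Finset.union_comm]; exact hxm t s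
        calc G' s * (G t * x t) = (G' s * G t) * x t := by ring
          _ ≤ (G (s ∩ t) * G' (s ∪ t)) * x (s ∪ t) :=
              mul_le_mul (wML s hs t ht hent) hxt (hx0 t) (mul_nonneg (hG _) (hG' _))
          _ = G (s ∩ t) * (G' (s ∪ t) * x (s ∪ t)) := by ring
  · rw [if_neg h1, zero_mul]
    exact mul_nonneg (n₃ _) (n₄ _)


end GateAbstract

end Summit.Ventures.PercRepro2.Coin
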